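import Mathlib.NumberTheory.Padics.Complex
import Mathlib.Analysis.SpecialFunctions.Pow.Real
import HarnessLib

/-!
# The rational order `ord : ℚ̄_p^× → ℚ` of the algebraic closure of `ℚ_p` (`‖x‖ = p^{−ord x}`)

Classical valuation theory of `ℚ̄_p` (J. Neukirch, *Algebraic Number Theory* (1999), Ch. II (4.8): the absolute value of
`ℚ_p` extends UNIQUELY to an algebraic extension `L`, by `|x| = |N_{L/ℚ_p}(x)|^{1/n}`; Ch. II §6 p.150 / (6.2): for the
algebraic closure the value group is `p^ℚ`, i.e. the exponential valuation `v_p` extends to `ℚ̄_p` with value group `ℚ`)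
[cite: NeukirchANT1999, Ch. II Thm (4.8) and §6 (6.2)]; S. Mochizuki, *The geometry of Frobenioids II* (2008), Ex. 1.1 (i)
p.7 ("`ord(O_K^▷)`", the order monoids of `p`-adic fields, all inside `ord(ℚ̄_p^×) ≅ ℚ`) [cite: MochizukiFrdII2008, Ex 1.1 (i) p.7].

For Mathlib's `ℚ̄_p = PadicAlgCl p` (normed by the spectral norm) we CONSTRUCT and PROVE:
* `exists_norm_eq_rpow_neg` — every `x ≠ 0` has `‖x‖ = p^{−q}` for some `q ∈ ℚ` (`q = v_p(a₀)/deg`, `a₀` the constant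
  coefficient of the minimal polynomial; Mathlib `spectralNorm_eq_norm_coeff_zero_rpow`), and `q` is unique;
* `ordFun p : PadicAlgCl p → ℚ` (with `ordFun 0 = 0`) and the homomorphism **`ordQ p : (PadicAlgCl p)ˣ →* Multiplicative ℚ`**,
  characterised by `norm_eq_rpow_neg_ordFun : ‖x‖ = p^{−ord x}`;
* compatibilities: `ordFun (a : ℚ_p) = v_p(a)` (`Padic.valuation`), `ordFun p = 1`, Galois invariance
  (`ordFun (σ x) = ordFun x`), `ord (x·y) = ord x + ord y`, `ord x⁻¹ = −ord x`, `ord (x^n) = n · ord x`;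
* order: `‖x‖ ≤ ‖y‖ ↔ ord y ≤ ord x`, `0 ≤ ord x ↔ ‖x‖ ≤ 1`, `ord x = 0 ↔ ‖x‖ = 1`;
* `ordFun_surjective` / `ordQ_surjective` — the value group is ALL of `ℚ` (roots of `X^n − p^m` in the algebraically closed `ℚ̄_p`).

abc-iut cell (layer L2, seat abc-iut-L2-d3 gen 10; arithmetic input A1 of the «C^{bs-fld} hull over the genuine base» carrier,
L2-lead R1112): the divisor of a constant of `ℚ̄_p` is its rational order.  Classical and Mathlib-only; nothing here concerns
[IUTchIII] Cor. 3.12 or takes a side on anything.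
-/

noncomputable section

namespace Literature.AlgebraicGeometry.Frobenioids

namespace RationalOrd

open Multiplicative

variable (p : ℕ) [hp : Fact p.Prime]

/-! ### The base `p` as a real number -/

/-- `1 < p` in `ℝ`. [folklore] -/
private theorem one_lt_p_real : (1 : ℝ) < p := by exact_mod_cast hp.out.one_lt

/-- `0 < p` in `ℝ`. [folklore] -/
private theorem p_real_pos : (0 : ℝ) < p := lt_trans zero_lt_one (one_lt_p_real p)

/-- `t ↦ p^t` is strictly monotone on `ℝ`. [folklore] -/
private theorem strictMono_rpow : StrictMono fun t : ℝ => (p : ℝ) ^ t :=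
  fun _ _ h => (Real.rpow_lt_rpow_left_iff (one_lt_p_real p)).mpr h

/-- `q ↦ p^{−q}` is injective on `ℚ` (uniqueness of the rational order). [folklore] -/
private theorem rpow_neg_ratCast_injective : Function.Injective fun q : ℚ => (p : ℝ) ^ (-(q : ℝ)) := by
  intro a b h
  have h' : (-(a : ℝ)) = -(b : ℝ) := (strictMono_rpow p).injective h
  exact_mod_cast neg_injective h'

/-! ### Existence: `‖x‖ = p^{−q}` with `q = v_p(a₀)/deg(minpoly)` -/

/-- **The absolute value of `ℚ̄_p` takes values in `p^ℚ`**: for `x ≠ 0` there is `q ∈ ℚ` with `‖x‖ = p^{−q}`, namely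
`q = v_p(a₀)/n` where `X^n + ⋯ + a₀` is the minimal polynomial of `x` over `ℚ_p` (`‖x‖ = ‖a₀‖^{1/n}`).
[cite: NeukirchANT1999, Ch. II Thm (4.8)] -/
theorem exists_norm_eq_rpow_neg (x : PadicAlgCl p) (hx : x ≠ 0) : ∃ q : ℚ, ‖x‖ = (p : ℝ) ^ (-(q : ℝ)) := by
  have hint : IsIntegral ℚ_[p] x := (Algebra.IsAlgebraic.isAlgebraic x).isIntegral
  have hdpos : 0 < (minpoly ℚ_[p] x).natDegree := minpoly.natDegree_pos hint
  have ha0 : (minpoly ℚ_[p] x).coeff 0 ≠ 0 := minpoly.coeff_zero_ne_zero hint hx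
  refine ⟨((minpoly ℚ_[p] x).coeff 0).valuation / (minpoly ℚ_[p] x).natDegree, ?_⟩
  rw [← PadicAlgCl.spectralNorm_eq, spectralNorm.spectralNorm_eq_norm_coeff_zero_rpow ℚ_[p] (PadicAlgCl p) x,
    Padic.norm_eq_zpow_neg_valuation ha0, ← Real.rpow_intCast, ← Real.rpow_mul (p_real_pos p).le]
  congr 1
  push_cast
  ring

/-! ### The rational order -/

/-- **The rational order `ord : ℚ̄_p → ℚ`** (with the convention `ord 0 = 0`): the unique `q` with `‖x‖ = p^{−q}`.
[cite: NeukirchANT1999, Ch. II §6 (6.2)] -/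
def ordFun (x : PadicAlgCl p) : ℚ :=
  haveI := Classical.dec (x = 0)
  if hx : x = 0 then 0 else Classical.choose (exists_norm_eq_rpow_neg p x hx)

/-- `ord 0 = 0` (our convention for the total function; the order lives on `ℚ̄_p^×`). [cite: NeukirchANT1999, Ch. II §6 (6.2)] -/
@[simp] theorem ordFun_zero : ordFun p 0 = 0 := by simp [ordFun]

/-- **`‖x‖ = p^{−ord x}`** for `x ≠ 0`. [cite: NeukirchANT1999, Ch. II Thm (4.8)] -/
theorem norm_eq_rpow_neg_ordFun {x : PadicAlgCl p} (hx : x ≠ 0) : ‖x‖ = (p : ℝ) ^ (-(ordFun p x : ℝ)) := by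
  rw [ordFun, dif_neg hx]
  exact Classical.choose_spec (exists_norm_eq_rpow_neg p x hx)

/-- Characterisation: `ord x = q ↔ ‖x‖ = p^{−q}` (`x ≠ 0`). [cite: NeukirchANT1999, Ch. II Thm (4.8)] -/
theorem ordFun_eq_iff {x : PadicAlgCl p} (hx : x ≠ 0) (q : ℚ) : ordFun p x = q ↔ ‖x‖ = (p : ℝ) ^ (-(q : ℝ)) := by
  constructor
  · rintro rfl
    exact norm_eq_rpow_neg_ordFun p hx
  · intro h
    exact rpow_neg_ratCast_injective p ((norm_eq_rpow_neg_ordFun p hx).symm.trans h)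

/-- `ord 1 = 0`. [cite: NeukirchANT1999, Ch. II Thm (4.8)] -/
@[simp] theorem ordFun_one : ordFun p 1 = 0 :=
  (ordFun_eq_iff p one_ne_zero 0).mpr (by simp)

/-- **`ord (x·y) = ord x + ord y`** (`x, y ≠ 0`). [cite: NeukirchANT1999, Ch. II Thm (4.8)] -/
theorem ordFun_mul {x y : PadicAlgCl p} (hx : x ≠ 0) (hy : y ≠ 0) : ordFun p (x * y) = ordFun p x + ordFun p y := by
  rw [ordFun_eq_iff p (mul_ne_zero hx hy), norm_mul, norm_eq_rpow_neg_ordFun p hx, norm_eq_rpow_neg_ordFun p hy,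
    ← Real.rpow_add (p_real_pos p)]
  congr 1
  push_cast
  ring

/-- `ord x⁻¹ = −ord x` (`x ≠ 0`). [cite: NeukirchANT1999, Ch. II Thm (4.8)] -/
theorem ordFun_inv {x : PadicAlgCl p} (hx : x ≠ 0) : ordFun p x⁻¹ = -ordFun p x := by
  have h := ordFun_mul p hx (inv_ne_zero hx)
  rw [mul_inv_cancel₀ hx, ordFun_one] at h
  linarith

/-- `ord (x^n) = n · ord x` (`x ≠ 0`). [cite: NeukirchANT1999, Ch. II Thm (4.8)] -/
theorem ordFun_pow {x : PadicAlgCl p} (hx : x ≠ 0) (n : ℕ) : ordFun p (x ^ n) = n * ordFun p x := by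
  induction n with
  | zero => simp
  | succ n ih =>
    rw [pow_succ, ordFun_mul p (pow_ne_zero n hx) hx, ih]
    push_cast
    ring

/-- `ord (x^n) = n · ord x` for `n ∈ ℤ` (`x ≠ 0`). [cite: NeukirchANT1999, Ch. II Thm (4.8)] -/
theorem ordFun_zpow {x : PadicAlgCl p} (hx : x ≠ 0) (n : ℤ) : ordFun p (x ^ n) = n * ordFun p x := by
  cases n with
  | ofNat n => rw [Int.ofNat_eq_natCast, zpow_natCast, ordFun_pow p hx]; push_cast; ring
  | negSucc n => rw [zpow_negSucc, ordFun_inv p (pow_ne_zero _ hx), ordFun_pow p hx]; push_cast; ring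

/-- **The rational order as a homomorphism `ord : ℚ̄_p^× → ℚ`** (written multiplicatively on the target).
[cite: NeukirchANT1999, Ch. II §6 (6.2)] -/
def ordQ : (PadicAlgCl p)ˣ →* Multiplicative ℚ where
  toFun x := ofAdd (ordFun p (x : PadicAlgCl p))
  map_one' := by simp
  map_mul' x y := by
    rw [← ofAdd_add, Units.val_mul, ordFun_mul p x.ne_zero y.ne_zero]

/-- `ordQ x = ord x`. [cite: NeukirchANT1999, Ch. II §6 (6.2)] -/
@[simp] theorem toAdd_ordQ (x : (PadicAlgCl p)ˣ) : toAdd (ordQ p x) = ordFun p (x : PadicAlgCl p) := rfl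

/-- `ordQ x = ofAdd (ord x)`. [cite: NeukirchANT1999, Ch. II §6 (6.2)] -/
theorem ordQ_apply (x : (PadicAlgCl p)ˣ) : ordQ p x = ofAdd (ordFun p (x : PadicAlgCl p)) := rfl

/-- **`‖x‖ = p^{−ordQ x}`** on units. [cite: NeukirchANT1999, Ch. II Thm (4.8)] -/
theorem norm_eq_rpow_neg_ordQ (x : (PadicAlgCl p)ˣ) :
    ‖(x : PadicAlgCl p)‖ = (p : ℝ) ^ (-((toAdd (ordQ p x) : ℚ) : ℝ)) :=
  norm_eq_rpow_neg_ordFun p x.ne_zero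

/-! ### Compatibility with `ℚ_p` and with the Galois action -/

/-- **`ord` extends the `p`-adic valuation of `ℚ_p`**: `ord (a) = v_p(a)` for `a ∈ ℚ_p^×` (Mathlib `Padic.valuation`).
[cite: NeukirchANT1999, Ch. II Thm (4.8)] -/
theorem ordFun_algebraMap {a : ℚ_[p]} (ha : a ≠ 0) : ordFun p (algebraMap ℚ_[p] (PadicAlgCl p) a) = a.valuation := by
  rw [ordFun_eq_iff p ((map_ne_zero _).mpr ha), PadicAlgCl.norm_extends, Padic.norm_eq_zpow_neg_valuation ha, ← Real.rpow_intCast]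
  congr 1
  push_cast
  ring

/-- **`ord p = 1`**. [cite: NeukirchANT1999, Ch. II §6 (6.2)] -/
theorem ordFun_natCast_p : ordFun p (p : PadicAlgCl p) = 1 := by
  have h := ordFun_algebraMap p (a := (p : ℚ_[p])) (by exact_mod_cast hp.out.ne_zero)
  rw [map_natCast, Padic.valuation_p] at h
  exact_mod_cast h

/-- `p ≠ 0` in `ℚ̄_p`. [folklore] -/
private theorem natCast_p_ne_zero : (p : PadicAlgCl p) ≠ 0 := by exact_mod_cast hp.out.ne_zero

/-- `ord (p^m) = m`. [cite: NeukirchANT1999, Ch. II §6 (6.2)] -/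
theorem ordFun_natCast_p_zpow (m : ℤ) : ordFun p ((p : PadicAlgCl p) ^ m) = m := by
  rw [ordFun_zpow p (natCast_p_ne_zero p), ordFun_natCast_p, mul_one]

/-- **Galois invariance**: `ord (σ x) = ord x` for every `ℚ_p`-automorphism `σ` of `ℚ̄_p` (the spectral norm is Galois
invariant, Mathlib `spectralNorm_eq_of_equiv`; uniqueness of the extended absolute value).
[cite: NeukirchANT1999, Ch. II Thm (4.8)] -/
theorem ordFun_algEquiv (σ : PadicAlgCl p ≃ₐ[ℚ_[p]] PadicAlgCl p) (x : PadicAlgCl p) : ordFun p (σ x) = ordFun p x := by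
  by_cases hx : x = 0
  · rw [hx, map_zero]
  · rw [ordFun_eq_iff p ((map_ne_zero σ).mpr hx), ← PadicAlgCl.spectralNorm_eq, ← spectralNorm_eq_of_equiv,
      PadicAlgCl.spectralNorm_eq]
    exact norm_eq_rpow_neg_ordFun p hx

/-- Galois invariance on units: `ordQ (σ x) = ordQ x`. [cite: NeukirchANT1999, Ch. II Thm (4.8)] -/
theorem ordQ_unitsMap_algEquiv (σ : PadicAlgCl p ≃ₐ[ℚ_[p]] PadicAlgCl p) (x : (PadicAlgCl p)ˣ) :
    ordQ p (Units.map (σ : PadicAlgCl p →* PadicAlgCl p) x) = ordQ p x := by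
  rw [ordQ_apply, ordQ_apply, Units.coe_map]
  exact congrArg ofAdd (ordFun_algEquiv p σ x)

/-- `ord` depends only on the norm: `‖x‖ = ‖y‖ → ord x = ord y`. [cite: NeukirchANT1999, Ch. II Thm (4.8)] -/
theorem ordFun_eq_of_norm_eq {x y : PadicAlgCl p} (h : ‖x‖ = ‖y‖) : ordFun p x = ordFun p y := by
  by_cases hx : x = 0
  · have hy : y = 0 := by rwa [hx, norm_zero, eq_comm, norm_eq_zero] at h
    rw [hx, hy]
  · have hy : y ≠ 0 := by
      intro hy; rw [hy, norm_zero, norm_eq_zero] at h; exact hx h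
    exact (ordFun_eq_iff p hx _).mpr (h.trans (norm_eq_rpow_neg_ordFun p hy))

/-! ### Order -/

/-- **`‖x‖ ≤ ‖y‖ ↔ ord y ≤ ord x`** (`x, y ≠ 0`). [cite: NeukirchANT1999, Ch. II Thm (4.8)] -/
theorem norm_le_norm_iff {x y : PadicAlgCl p} (hx : x ≠ 0) (hy : y ≠ 0) : ‖x‖ ≤ ‖y‖ ↔ ordFun p y ≤ ordFun p x := by
  rw [norm_eq_rpow_neg_ordFun p hx, norm_eq_rpow_neg_ordFun p hy, (strictMono_rpow p).le_iff_le, neg_le_neg_iff,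
    Rat.cast_le]

/-- `‖x‖ < ‖y‖ ↔ ord y < ord x` (`x, y ≠ 0`). [cite: NeukirchANT1999, Ch. II Thm (4.8)] -/
theorem norm_lt_norm_iff {x y : PadicAlgCl p} (hx : x ≠ 0) (hy : y ≠ 0) : ‖x‖ < ‖y‖ ↔ ordFun p y < ordFun p x := by
  rw [norm_eq_rpow_neg_ordFun p hx, norm_eq_rpow_neg_ordFun p hy, (strictMono_rpow p).lt_iff_lt, neg_lt_neg_iff,
    Rat.cast_lt]

/-- **`0 ≤ ord x ↔ ‖x‖ ≤ 1`** (`x ≠ 0`): the valuation ring of `ℚ̄_p`. [cite: NeukirchANT1999, Ch. II §6 (6.2)] -/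
theorem ordFun_nonneg_iff {x : PadicAlgCl p} (hx : x ≠ 0) : 0 ≤ ordFun p x ↔ ‖x‖ ≤ 1 := by
  rw [← ordFun_one p, ← norm_le_norm_iff p hx one_ne_zero, norm_one]

/-- `0 < ord x ↔ ‖x‖ < 1` (`x ≠ 0`): the maximal ideal. [cite: NeukirchANT1999, Ch. II §6 (6.2)] -/
theorem ordFun_pos_iff {x : PadicAlgCl p} (hx : x ≠ 0) : 0 < ordFun p x ↔ ‖x‖ < 1 := by
  rw [← ordFun_one p, ← norm_lt_norm_iff p hx one_ne_zero, norm_one]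

/-- **`ord x = 0 ↔ ‖x‖ = 1`** (`x ≠ 0`): the units of the valuation ring = the kernel of `ord`.
[cite: NeukirchANT1999, Ch. II §6 (6.2)] -/
theorem ordFun_eq_zero_iff {x : PadicAlgCl p} (hx : x ≠ 0) : ordFun p x = 0 ↔ ‖x‖ = 1 := by
  rw [ordFun_eq_iff p hx]
  simp

/-- The kernel of `ordQ` is the group of elements of norm `1`. [cite: NeukirchANT1999, Ch. II §6 (6.2)] -/
theorem mem_ker_ordQ_iff (x : (PadicAlgCl p)ˣ) : x ∈ (ordQ p).ker ↔ ‖(x : PadicAlgCl p)‖ = 1 := by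
  rw [MonoidHom.mem_ker, ordQ_apply, ← ofAdd_zero, ofAdd.injective.eq_iff, ordFun_eq_zero_iff p x.ne_zero]

/-! ### The value group is `ℚ` -/

/-- **The value group of `ℚ̄_p` is all of `ℚ`**: every rational number `m/n` is the order of some `x ≠ 0` (an `n`-th root of
`p^m` in the algebraically closed field `ℚ̄_p`). [cite: NeukirchANT1999, Ch. II §6 (6.2)] -/
theorem exists_ordFun_eq (q : ℚ) : ∃ x : PadicAlgCl p, x ≠ 0 ∧ ordFun p x = q := by
  obtain ⟨z, hz⟩ := IsAlgClosed.exists_pow_nat_eq ((p : PadicAlgCl p) ^ q.num) q.den_pos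
  have hz0 : z ≠ 0 := by
    intro h
    rw [h, zero_pow q.den_pos.ne'] at hz
    exact zpow_ne_zero q.num (natCast_p_ne_zero p) hz.symm
  refine ⟨z, hz0, ?_⟩
  have h := ordFun_pow p hz0 q.den
  rw [hz, ordFun_natCast_p_zpow] at h
  have hden : (q.den : ℚ) ≠ 0 := by exact_mod_cast q.den_pos.ne'
  calc ordFun p z = (q.den : ℚ) * ordFun p z / q.den := by rw [mul_comm, mul_div_assoc, div_self hden, mul_one]
    _ = q.num / q.den := by rw [← h]
    _ = q := Rat.num_div_den q

/-- `ord : ℚ̄_p → ℚ` is surjective. [cite: NeukirchANT1999, Ch. II §6 (6.2)] -/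
theorem ordFun_surjective : Function.Surjective (ordFun p) := fun q => by
  obtain ⟨x, -, hx⟩ := exists_ordFun_eq p q
  exact ⟨x, hx⟩

/-- **`ordQ : ℚ̄_p^× → ℚ` is surjective** (value group `ℚ`). [cite: NeukirchANT1999, Ch. II §6 (6.2)] -/
theorem ordQ_surjective : Function.Surjective (ordQ p) := fun q => by
  obtain ⟨x, hx0, hx⟩ := exists_ordFun_eq p (toAdd q)
  exact ⟨Units.mk0 x hx0, by rw [ordQ_apply, Units.val_mk0, hx, ofAdd_toAdd]⟩

end RationalOrd

end Literature.AlgebraicGeometry.Frobenioids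

end
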